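import Summits.NavierStokesRegularity.NavierStokesRegularity.Theses.CertifiedBlowup
import Summits.NavierStokesRegularity.NavierStokesRegularity.Theorems.Target.Negative.NormalForms
import Summits.NavierStokesRegularity.NavierStokesRegularity.Theorems.SwirlThresholdSwirlSupStrictDecrease
import Literature.Analysis.FluidPDE.ClassicalSolutionRescale
import Literature.Analysis.FluidPDE.LerayHopfNSRescale
import Literature.Analysis.FluidPDE.NSViscosityRescaling
import Literature.Analysis.FluidPDE.NSLerayHopfABCScaling
import Literature.Analysis.FluidPDE.SereginSverak2002PressureLowerBoundProofs
import Literature.Analysis.FluidPDE.PalasekQuantitativeAxisymReduction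
import HarnessLib

/-!
# Crux `CertifiedBlowupAxisymBlowup` (stmt-NavierStokesRegularity-0727): the pair `(ν, T)` is immaterial

Summit `NavierStokesRegularity`, thesis `CertifiedBlowup`, crux `CertifiedBlowupAxisymBlowup`
(X5a_axi; line `compact-amplification`, stub `certifiedBlowupAxisymBlowup_iff_forall_nu_T`).
The crux asks for SOME viscosity `ν > 0` and SOME lifespan `T > 0` carrying a maximal classical
solution `(u, p)` of the unforced Navier–Stokes system on `ℝ³ × [0, T)`, Leray–Hopf on `[0, T)`
from its datum `u 0`, with `u 0` rapidly decaying and axisymmetric. This file records the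
kernel-checked NORMAL FORM

  `CertifiedBlowupAxisymBlowup ↔ ∀ ν > 0, ∀ T > 0, ∃ (u, p), (the same four clauses at (ν, T))`

(`certifiedBlowupAxisymBlowup_iff_forall_nu_T`): one witness at one `(ν, T)` yields a witness at
every `(ν', T')`, by the two exact symmetries of the hypothesis class —

* the viscosity scaling `v(s, x) = c u(c s, x)`, `q(s, x) = c² p(c s, x)` (`c > 0`; Tao 2011,
  fn. 3): viscosity `ν ↦ c ν`, lifespan `T ↦ T / c`, datum `u 0 ↦ c • u 0`
  (tree: `IsClassicalNSSolutionOn.stRescale` with `α = β = c`, `γ = 1`;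
  `IsLerayHopfOn.viscosityRescale`; `hasRapidSpatialDecay_const_smul`;
  `SwirlSupStrictDecrease.isAxisymmetric_const_smul`);
* Leray's similarity `w(s, y) = c u(c² s, c y)`, `ϖ(s, y) = c² p(c² s, c y)` (`c > 0`; Leray 1934,
  §20): same viscosity, lifespan `T ↦ T / c²`, datum `u 0 ↦ c • u 0 (c • ·)`
  (tree: `IsClassicalNSSolutionOn.nsRescale_holds`, `isLerayHopfOn_nsRescale`,
  `Target.Negative.hasRapidSpatialDecay_nsRescaleData`, `IsAxisymmetric.nsRescale_slice`).

Maximality (no classical extension past the lifespan) is transported by scaling a putative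
extension of the rescaled solution BACK with the inverse parameter (`c⁻¹`), which would extend
`u` past `T`. Given a witness at `(ν, T)` and a target `(ν', T')`, apply the viscosity scaling with
`c = ν'/ν` (lifespan `T₁ = T/(ν'/ν)`) and then Leray's similarity with `c' = √(T₁/T')` (lifespan
`T₁/c'² = T'`). The converse direction is specialisation to `ν = T = 1`.

No new definitions, no named-fact hypotheses, no `sorry`.

## References

* J. Leray, *Sur le mouvement d'un liquide visqueux emplissant l'espace*, Acta Math. 63 (1934),
  §20 (the similarity transformation). [Leray1934]
* T. Tao, *Localisation and compactness properties of the Navier–Stokes global regularity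
  problem*, arXiv:1108.1165 = Anal. PDE 6 (2013), footnote 3 (viscosity normalisation). [Tao2011]
* J. T. Beale, T. Kato, A. Majda, Comm. Math. Phys. 94 (1984), §1 (maximal interval of smooth
  existence). [BealeKatoMajda1984]
-/

-- the summit and its single problem share the name (D-0017 nested layout)
set_option linter.dupNamespace false

noncomputable section

open Set Function

namespace Summit.NavierStokesRegularity.NavierStokesRegularity.Theorems.CertifiedBlowupAxisymBlowup.CompactAmplification

open Literature.Analysis.FluidPDE
open Summit.NavierStokesRegularity.NavierStokesRegularity.Theorems.Target.Negative
  (hasRapidSpatialDecay_nsRescaleData)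
open Summit.NavierStokesRegularity.NavierStokesRegularity.Theorems.SwirlSupStrictDecrease
  (isAxisymmetric_const_smul)

/-! ### The viscosity scaling `v(s, x) = c u(c s, x)`: `ν ↦ c ν`, `T ↦ T / c` -/

/-- **Viscosity scaling of classical solutions on `[0, T)`** (Tao 2011, fn. 3): if `(u, p)` is a
classical solution of the unforced system with viscosity `ν` on `[0, T)`, then for `c > 0` the pair
`v(s, x) = c u(c s, x)`, `q(s, x) = c² p(c s, x)` (`timeRescale c c u`, `timeRescale c (c ^ 2) p`)
is a classical solution with viscosity `c ν` on `[0, T / c)` — the case `α = β = c`, `γ = 1`,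
`t₀ = 0`, `x₀ = 0` of the tree's `IsClassicalNSSolutionOn.stRescale`. [cite: Tao2011, footnote 3] -/
theorem isClassicalNSSolutionOn_Ico_timeRescale {ν T : ℝ}
    {u : ℝ → EuclideanSpace ℝ (Fin 3) → EuclideanSpace ℝ (Fin 3)}
    {p : ℝ → EuclideanSpace ℝ (Fin 3) → ℝ}
    (h : IsClassicalNSSolutionOn (Ico 0 T) ν 0 u p) {c : ℝ} (hc : 0 < c) :
    IsClassicalNSSolutionOn (Ico 0 (T / c)) (c * ν) 0 (timeRescale c c u)
      (timeRescale c (c ^ 2) p) := by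
  have key := h.stRescale hc one_pos (mul_one c).symm 0 0
  have hset : ((fun r => (0 : ℝ) + c * r) ⁻¹' Ico 0 T) = Ico 0 (T / c) := by
    have e : (fun r => (0 : ℝ) + c * r) = fun r => c * r := funext fun r => zero_add _
    rw [e, preimage_const_mul_Ico₀ _ _ hc, zero_div]
  have hu : (c • stPull c 1 0 (0 : EuclideanSpace ℝ (Fin 3)) u) = timeRescale c c u := by
    funext s x
    rw [smul_stPull_apply, timeRescale_apply, zero_add, zero_add, one_smul]
  have hp : (c ^ 2 • stPull c 1 0 (0 : EuclideanSpace ℝ (Fin 3)) p) = timeRescale c (c ^ 2) p := by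
    funext s x
    rw [smul_stPull_apply, timeRescale_apply, zero_add, zero_add, one_smul]
  rw [hset, smul_stPull_zero, div_one, hu, hp] at key
  exact key

/-- A classical extension past `T` of `u` rescales to a classical extension past `T / c` of
`v(s, x) = c u(c s, x)` at viscosity `c ν` (`c > 0`): an extension `u'` on `[0, T')`, `T' > T`,
gives the extension `c u'(c s, x)` on `[0, T'/c)`, agreeing with `v` on `[0, T/c)`
(Beale–Kato–Majda 1984, §1; Tao 2011, fn. 3). [cite: Tao2011, footnote 3] -/
theorem hasSmoothExtensionPast_timeRescale {ν T : ℝ}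
    {u : ℝ → EuclideanSpace ℝ (Fin 3) → EuclideanSpace ℝ (Fin 3)}
    (h : HasSmoothExtensionPast ν 0 u T) {c : ℝ} (hc : 0 < c) :
    HasSmoothExtensionPast (c * ν) 0 (timeRescale c c u) (T / c) := by
  obtain ⟨T', hT', u', p', hcl', hagree⟩ := h
  refine ⟨T' / c, div_lt_div_of_pos_right hT' hc, timeRescale c c u', timeRescale c (c ^ 2) p',
    isClassicalNSSolutionOn_Ico_timeRescale hcl' hc, fun t ht => ?_⟩
  have hct : c * t ∈ Ico 0 T := ⟨mul_nonneg hc.le ht.1, (lt_div_iff₀' hc).1 ht.2⟩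
  funext x
  rw [timeRescale_apply, timeRescale_apply, hagree (c * t) hct]

/-- **Maximality is preserved by the viscosity scaling**: if `(u, p)` is a maximal smooth solution
with viscosity `ν` and lifespan `T`, then `(c u(c ·, ·), c² p(c ·, ·))` is a maximal smooth solution
with viscosity `c ν` and lifespan `T / c` (`c > 0`): a classical extension of the rescaled solution
past `T / c` would scale back (parameter `c⁻¹`) to a classical extension of `u` past `T`
(Beale–Kato–Majda 1984, §1; Tao 2011, fn. 3). [cite: Tao2011, footnote 3] -/
theorem isMaximalSmoothSolution_timeRescale {ν T : ℝ}
    {u : ℝ → EuclideanSpace ℝ (Fin 3) → EuclideanSpace ℝ (Fin 3)}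
    {p : ℝ → EuclideanSpace ℝ (Fin 3) → ℝ}
    (h : IsMaximalSmoothSolution ν 0 u p T) {c : ℝ} (hc : 0 < c) :
    IsMaximalSmoothSolution (c * ν) 0 (timeRescale c c u) (timeRescale c (c ^ 2) p) (T / c) := by
  refine ⟨isClassicalNSSolutionOn_Ico_timeRescale h.1 hc, fun hext => h.2 ?_⟩
  have key := hasSmoothExtensionPast_timeRescale hext (inv_pos.2 hc)
  have e1 : c⁻¹ * (c * ν) = ν := inv_mul_cancel_left₀ hc.ne' ν
  have e2 : timeRescale c⁻¹ c⁻¹ (timeRescale c c u) = u := by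
    funext s x
    rw [timeRescale_apply, timeRescale_apply, smul_smul, inv_mul_cancel₀ hc.ne', one_smul,
      ← mul_assoc, mul_inv_cancel₀ hc.ne', one_mul]
  have e3 : T / c / c⁻¹ = T := by
    rw [div_div, mul_inv_cancel₀ hc.ne', div_one]
  rwa [e1, e2, e3] at key

/-- **The viscosity scaling transports a witness of the crux from `(ν, T)` to `(c ν, T / c)`**
(`c > 0`, `T > 0`): maximality by `isMaximalSmoothSolution_timeRescale`, the Leray–Hopf property
by the tree's `IsLerayHopfOn.viscosityRescale` (datum `c • u 0 = v 0`, force `0 ↦ 0`), rapid decay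
of the datum by `hasRapidSpatialDecay_const_smul` (the datum of a classical solution on `[0, T)`,
`T > 0`, is smooth) and axisymmetry by `isAxisymmetric_const_smul` (rotations are linear)
(Tao 2011, fn. 3). [cite: Tao2011, footnote 3] -/
theorem exists_witness_timeRescale {ν T : ℝ} (hT : 0 < T)
    {u : ℝ → EuclideanSpace ℝ (Fin 3) → EuclideanSpace ℝ (Fin 3)}
    {p : ℝ → EuclideanSpace ℝ (Fin 3) → ℝ}
    (hmax : IsMaximalSmoothSolution ν 0 u p T) (hLH : IsLerayHopfOn T ν 0 (u 0) u)
    (hdec : HasRapidSpatialDecay (u 0)) (hax : IsAxisymmetric (u 0)) {c : ℝ} (hc : 0 < c) :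
    ∃ (v : ℝ → EuclideanSpace ℝ (Fin 3) → EuclideanSpace ℝ (Fin 3))
      (q : ℝ → EuclideanSpace ℝ (Fin 3) → ℝ),
      IsMaximalSmoothSolution (c * ν) 0 v q (T / c) ∧ IsLerayHopfOn (T / c) (c * ν) 0 (v 0) v ∧
        HasRapidSpatialDecay (v 0) ∧ IsAxisymmetric (v 0) := by
  have hv0 : c • u 0 = timeRescale c c u 0 := by
    funext x
    rw [Pi.smul_apply, timeRescale_apply, mul_zero]
  refine ⟨timeRescale c c u, timeRescale c (c ^ 2) p, isMaximalSmoothSolution_timeRescale hmax hc,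
    ?_, ?_, ?_⟩
  · have h := hLH.viscosityRescale hc
    rwa [timeRescale_zero_force, hv0] at h
  · rw [← hv0]
    exact SereginSverak2002_pressureOneSidedBound.hasRapidSpatialDecay_const_smul
      (hmax.1.contDiff_velocity ⟨le_rfl, hT⟩) hdec c
  · rw [← hv0]
    exact isAxisymmetric_const_smul c hax

/-! ### Leray's similarity `w(s, y) = c u(c² s, c y)`: same `ν`, `T ↦ T / c²` -/

/-- **Leray's similarity of classical solutions on `[0, T)`** (Leray 1934, §20): if `(u, p)` is a
classical solution of the unforced system with viscosity `ν` on `[0, T)`, then for `c > 0` the pair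
`(c u(c² ·, c ·), c² p(c² ·, c ·))` (`nsRescale c u`, `nsRescalePressure c p`) is a classical
solution with the same viscosity on `[0, T / c²)` (tree `IsClassicalNSSolutionOn.nsRescale_holds`,
time set `(c² ·)⁻¹' [0, T) = [0, T/c²)`, force `0 ↦ 0`). [cite: Leray1934, §20] -/
theorem isClassicalNSSolutionOn_Ico_nsRescale {ν T : ℝ}
    {u : ℝ → EuclideanSpace ℝ (Fin 3) → EuclideanSpace ℝ (Fin 3)}
    {p : ℝ → EuclideanSpace ℝ (Fin 3) → ℝ}
    (h : IsClassicalNSSolutionOn (Ico 0 T) ν 0 u p) {c : ℝ} (hc : 0 < c) :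
    IsClassicalNSSolutionOn (Ico 0 (T / c ^ 2)) ν 0 (nsRescale c u) (nsRescalePressure c p) := by
  have key := IsClassicalNSSolutionOn.nsRescale_holds h hc
  rwa [preimage_const_mul_Ico₀ _ _ (pow_pos hc 2), zero_div, nsRescaleForce_zero] at key

/-- A classical extension past `T` of `u` rescales to a classical extension past `T / c²` of
`c u(c² ·, c ·)` at the same viscosity (`c > 0`): an extension `u'` on `[0, T')`, `T' > T`, gives
the extension `c u'(c² ·, c ·)` on `[0, T'/c²)` (Leray 1934, §20; Beale–Kato–Majda 1984, §1). [cite: Leray1934, §20] -/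
theorem hasSmoothExtensionPast_nsRescale {ν T : ℝ}
    {u : ℝ → EuclideanSpace ℝ (Fin 3) → EuclideanSpace ℝ (Fin 3)}
    (h : HasSmoothExtensionPast ν 0 u T) {c : ℝ} (hc : 0 < c) :
    HasSmoothExtensionPast ν 0 (nsRescale c u) (T / c ^ 2) := by
  obtain ⟨T', hT', u', p', hcl', hagree⟩ := h
  have hc2 : 0 < c ^ 2 := pow_pos hc 2
  refine ⟨T' / c ^ 2, div_lt_div_of_pos_right hT' hc2, nsRescale c u', nsRescalePressure c p',
    isClassicalNSSolutionOn_Ico_nsRescale hcl' hc, fun t ht => ?_⟩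
  have hct : c ^ 2 * t ∈ Ico 0 T := ⟨mul_nonneg hc2.le ht.1, (lt_div_iff₀' hc2).1 ht.2⟩
  funext x
  rw [nsRescale_apply, nsRescale_apply, hagree (c ^ 2 * t) hct]

/-- **Maximality is preserved by Leray's similarity**: if `(u, p)` is a maximal smooth solution
with viscosity `ν` and lifespan `T`, then `(c u(c² ·, c ·), c² p(c² ·, c ·))` is a maximal smooth
solution with viscosity `ν` and lifespan `T / c²` (`c > 0`): a classical extension of the rescaled
solution past `T / c²` would scale back (parameter `c⁻¹`, `nsRescale_mul`, `nsRescale_one`) to a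
classical extension of `u` past `T` (Leray 1934, §20; Beale–Kato–Majda 1984, §1). [cite: Leray1934, §20] -/
theorem isMaximalSmoothSolution_nsRescale {ν T : ℝ}
    {u : ℝ → EuclideanSpace ℝ (Fin 3) → EuclideanSpace ℝ (Fin 3)}
    {p : ℝ → EuclideanSpace ℝ (Fin 3) → ℝ}
    (h : IsMaximalSmoothSolution ν 0 u p T) {c : ℝ} (hc : 0 < c) :
    IsMaximalSmoothSolution ν 0 (nsRescale c u) (nsRescalePressure c p) (T / c ^ 2) := by
  refine ⟨isClassicalNSSolutionOn_Ico_nsRescale h.1 hc, fun hext => h.2 ?_⟩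
  have key := hasSmoothExtensionPast_nsRescale hext (inv_pos.2 hc)
  have e2 : nsRescale c⁻¹ (nsRescale c u) = u := by
    rw [← nsRescale_mul, mul_inv_cancel₀ hc.ne', nsRescale_one]
  have e3 : T / c ^ 2 / c⁻¹ ^ 2 = T := by
    rw [inv_pow, div_div, mul_inv_cancel₀ (pow_ne_zero 2 hc.ne'), div_one]
  rwa [e2, e3] at key

/-- **Leray's similarity transports a witness of the crux from `(ν, T)` to `(ν, T / c²)`**
(`c > 0`, `T > 0`): maximality by `isMaximalSmoothSolution_nsRescale`, the Leray–Hopf property by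
the tree's `isLerayHopfOn_nsRescale` (datum `c • u 0 (c • ·) = w 0`, force `0 ↦ 0`), rapid decay
of the datum by `Target.Negative.hasRapidSpatialDecay_nsRescaleData` (Schwartz decay is dilation
invariant; the datum is smooth) and axisymmetry by `IsAxisymmetric.nsRescale_slice` (rotations
about the axis commute with dilations) (Leray 1934, §20). [cite: Leray1934, §20] -/
theorem exists_witness_nsRescale {ν T : ℝ} (hT : 0 < T)
    {u : ℝ → EuclideanSpace ℝ (Fin 3) → EuclideanSpace ℝ (Fin 3)}
    {p : ℝ → EuclideanSpace ℝ (Fin 3) → ℝ}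
    (hmax : IsMaximalSmoothSolution ν 0 u p T) (hLH : IsLerayHopfOn T ν 0 (u 0) u)
    (hdec : HasRapidSpatialDecay (u 0)) (hax : IsAxisymmetric (u 0)) {c : ℝ} (hc : 0 < c) :
    ∃ (w : ℝ → EuclideanSpace ℝ (Fin 3) → EuclideanSpace ℝ (Fin 3))
      (r : ℝ → EuclideanSpace ℝ (Fin 3) → ℝ),
      IsMaximalSmoothSolution ν 0 w r (T / c ^ 2) ∧ IsLerayHopfOn (T / c ^ 2) ν 0 (w 0) w ∧
        HasRapidSpatialDecay (w 0) ∧ IsAxisymmetric (w 0) := by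
  refine ⟨nsRescale c u, nsRescalePressure c p, isMaximalSmoothSolution_nsRescale hmax hc,
    ?_, ?_, ?_⟩
  · have h := isLerayHopfOn_nsRescale hLH hc
    rwa [nsRescaleForce_zero, ← nsRescale_zero_time c u] at h
  · rw [nsRescale_zero_time]
    exact hasRapidSpatialDecay_nsRescaleData (hmax.1.contDiff_velocity ⟨le_rfl, hT⟩) hdec hc
  · exact IsAxisymmetric.nsRescale_slice (by rwa [mul_zero])

/-! ### The normal form -/

/-- **Normal form of the crux `CertifiedBlowupAxisymBlowup`: the pair `(ν, T)` is immaterial.**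
The crux (SOME `ν > 0`, SOME `T > 0` carry a maximal classical solution of the unforced
Navier–Stokes system on `ℝ³ × [0, T)`, Leray–Hopf on `[0, T)` from a rapidly decaying
axisymmetric datum) is equivalent to the same statement for EVERY `ν > 0` and EVERY `T > 0`.
`←` is specialisation (`ν = T = 1`). `→`: a witness at `(ν, T)` is carried to `(ν', T/(ν'/ν))` by
the viscosity scaling with `c = ν'/ν` (`exists_witness_timeRescale`) and then to `(ν', T')` by
Leray's similarity with `c' = √((T/(ν'/ν))/T')` (`exists_witness_nsRescale`; `(T/(ν'/ν))/c'² = T'`)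
(Leray 1934, §20; Tao 2011, fn. 3). [cite: Leray1934, §20] -/
theorem certifiedBlowupAxisymBlowup_iff_forall_nu_T : Summit.NavierStokesRegularity.NavierStokesRegularity.Theses.CertifiedBlowup.CertifiedBlowupAxisymBlowup ↔ ∀ ν : ℝ, 0 < ν → ∀ T : ℝ, 0 < T → ∃ (u : ℝ → EuclideanSpace ℝ (Fin 3) → EuclideanSpace ℝ (Fin 3)) (p : ℝ → EuclideanSpace ℝ (Fin 3) → ℝ), IsMaximalSmoothSolution ν 0 u p T ∧ IsLerayHopfOn T ν 0 (u 0) u ∧ HasRapidSpatialDecay (u 0) ∧ IsAxisymmetric (u 0) := by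
  unfold Summit.NavierStokesRegularity.NavierStokesRegularity.Theses.CertifiedBlowup.CertifiedBlowupAxisymBlowup
  constructor
  · rintro ⟨ν, hν, T, hT, u, p, hmax, hLH, hdec, hax⟩ ν' hν' T' hT'
    -- Step 1: viscosity scaling with `c = ν'/ν`: viscosity `ν'`, lifespan `T₁ = T/(ν'/ν)`.
    have hc : 0 < ν' / ν := div_pos hν' hν
    have hT₁ : 0 < T / (ν' / ν) := div_pos hT hc
    obtain ⟨v, q, hvmax, hvLH, hvdec, hvax⟩ := exists_witness_timeRescale hT hmax hLH hdec hax hc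
    rw [div_mul_cancel₀ ν' hν.ne'] at hvmax hvLH
    -- Step 2: Leray's similarity with `c' = √(T₁/T')`: viscosity `ν'`, lifespan `T₁/c'² = T'`.
    have hc' : 0 < Real.sqrt (T / (ν' / ν) / T') := Real.sqrt_pos.2 (div_pos hT₁ hT')
    obtain ⟨w, r, hwmax, hwLH, hwdec, hwax⟩ := exists_witness_nsRescale hT₁ hvmax hvLH hvdec hvax hc'
    rw [Real.sq_sqrt (div_pos hT₁ hT').le, div_div_cancel₀ hT₁.ne'] at hwmax hwLH
    exact ⟨w, r, hwmax, hwLH, hwdec, hwax⟩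
  · intro h
    exact ⟨1, one_pos, 1, one_pos, h 1 one_pos 1 one_pos⟩

end Summit.NavierStokesRegularity.NavierStokesRegularity.Theorems.CertifiedBlowupAxisymBlowup.CompactAmplification

end
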